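import Summits.CriticalPhenomena.Ising3D.Control2DMidCheck
import Mathlib.Tactic.NormNum
import HarnessLib

/-!
# The 2D control: soundness of the kernel checker for obligation (M)
(cell `pub-ising3x`, seat controls-1; companion of `Control2DMidCheck.lean` / `Control2DMidScheme.lean`)

HONEST FRAMING: lottery ticket; floor = tightest certified 3D Ising CFT bounds; no exact-solution
claim without a proof.

Inclusion theorems for the term enclosures of `Control2DMidCheck.lean` (`powSum_mem`, `xyPow_mem`,
`chAt_mem`, `xyHalf_mem`, `Fval_mem`), the three point sums (`ptSums_spec`), one cell
(`Phi_nonneg_of_cellOK`, via `Control2DMidScheme.cell_nonneg_of_convex`), a refined unit cell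
(`fineOK_sound`), an index `j` (`checkJ_sound`), a chunk (`checkRange_sound`), and the END RESULT
`pair_nonneg_of_checkAll`: if `checkJ` passes for every `j < Δ⋆` then obligation (M) holds —
`φ[F_-[x^a y^b + x^b y^a]] ≥ 0` for all `a, b ≥ 0`, `E₀ ≤ a + b < Δ⋆`, `a - b ∈ ℤ`. All PROVED; no
numerical fact enters except through the kernel's evaluation of the checker.
-/

namespace Summit.CriticalPhenomena.Ising3D.Control2D

open Set Finset
open Literature.MathematicalPhysics.QuantumFieldTheory.ConformalBootstrap3D

/-! ### Soundness of the term enclosures -/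

section sound

variable {P : ℕ}

/-- `powSum ∋ x^j + y^j`. [folklore] -/
theorem powSum_mem {d : MDat} {r : RDat} (h : d.Models P r) (j : ℕ) :
    (powSum P d j).mem P (r.x ^ j + r.y ^ j) := by
  have hxd : (0 : ℝ) < d.xd := by exact_mod_cast h.xd_pos
  have hyd : (0 : ℝ) < d.yd := by exact_mod_cast h.yd_pos
  have hxd' : (d.xd : ℝ) ^ j ≠ 0 := pow_ne_zero _ hxd.ne'
  have hyd' : (d.yd : ℝ) ^ j ≠ 0 := pow_ne_zero _ hyd.ne'
  have e : r.x ^ j + r.y ^ j =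
      ((d.xn ^ j * d.yd ^ j + d.yn ^ j * d.xd ^ j : ℕ) : ℝ) / ((d.xd ^ j * d.yd ^ j : ℕ) : ℝ) := by
    rw [h.x_eq, h.y_eq, div_pow, div_pow]; push_cast
    field_simp
  rw [e]
  exact NI.mem_ofNatFrac P (Nat.mul_pos (Nat.pow_pos h.xd_pos) (Nat.pow_pos h.yd_pos))

/-- `xyPow ∋ (xy)^q`. [folklore] -/
theorem xyPow_mem {d : MDat} {r : RDat} (h : d.Models P r) (q : ℕ) :
    (xyPow P d q).mem P ((r.x * r.y) ^ q) := by
  have hxd : (0 : ℝ) < d.xd := by exact_mod_cast h.xd_pos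
  have hyd : (0 : ℝ) < d.yd := by exact_mod_cast h.yd_pos
  have e : (r.x * r.y) ^ q = ((((d.xn * d.yn) ^ q : ℕ) : ℝ)) / ((((d.xd * d.yd) ^ q : ℕ) : ℝ)) := by
    rw [h.x_eq, h.y_eq]; push_cast
    rw [div_mul_div_comm, div_pow]
  rw [e]
  exact NI.mem_ofNatFrac P (Nat.pow_pos (Nat.mul_pos h.xd_pos h.yd_pos))

/-- `chAt k ∋ (xy)^{1/2^{k+1}}` (beyond the chain: the value lies in `[0, 1]`). [folklore] -/
theorem chAt_mem {d : MDat} {r : RDat} (h : d.Models P r) (hr : r.ok) (k : ℕ) :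
    (chAt P d k).mem P ((r.x * r.y) ^ ((1 : ℝ) / 2 ^ (k + 1))) := by
  unfold chAt
  by_cases hk : k < d.ch.length
  · rw [List.getD_eq_getElem _ _ hk]; exact h.chain k hk
  · rw [List.getD_eq_default _ _ (not_lt.mp hk)]
    obtain ⟨_, hx0, hx1, hy0, hy1⟩ := hr
    have hxy0 : 0 ≤ r.x * r.y := by positivity
    have hxy1 : r.x * r.y ≤ 1 := by nlinarith
    have ht0 : 0 ≤ (r.x * r.y) ^ ((1 : ℝ) / 2 ^ (k + 1)) := Real.rpow_nonneg hxy0 _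
    have ht1 : (r.x * r.y) ^ ((1 : ℝ) / 2 ^ (k + 1)) ≤ 1 := Real.rpow_le_one hxy0 hxy1 (by positivity)
    have h2P : (0 : ℝ) ≤ 2 ^ P := by positivity
    refine ⟨?_, ?_⟩
    · simpa using mul_nonneg ht0 h2P
    · have : (r.x * r.y) ^ ((1 : ℝ) / 2 ^ (k + 1)) * 2 ^ P ≤ 1 * 2 ^ P :=
        mul_le_mul_of_nonneg_right ht1 h2P
      simpa using this

/-- `xyHalf m ∋ (xy)^{m/2}`. [folklore] -/
theorem xyHalf_mem {d : MDat} {r : RDat} (h : d.Models P r) (hr : r.ok) (m : ℕ) :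
    (xyHalf P d m).mem P ((r.x * r.y) ^ ((m : ℝ) / 2)) := by
  obtain ⟨_, hx0, _, hy0, _⟩ := hr
  have hxy : 0 < r.x * r.y := mul_pos hx0 hy0
  unfold xyHalf
  split_ifs with hm
  · obtain ⟨q, hq⟩ : ∃ q, m = 2 * q := ⟨m / 2, by omega⟩
    have hq' : m / 2 = q := by omega
    have e : (r.x * r.y) ^ ((m : ℝ) / 2) = (r.x * r.y) ^ (m / 2) := by
      rw [← Real.rpow_natCast _ (m / 2), hq', hq]; push_cast; ring_nf
    rw [e]; exact xyPow_mem h (m / 2)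
  · obtain ⟨q, hq⟩ : ∃ q, m = 2 * q + 1 := ⟨m / 2, by omega⟩
    have hq' : m / 2 = q := by omega
    have e : (r.x * r.y) ^ ((m : ℝ) / 2) = (r.x * r.y) ^ (m / 2) * (r.x * r.y) ^ ((1 : ℝ) / 2 ^ (0 + 1)) := by
      rw [← Real.rpow_natCast _ (m / 2), ← Real.rpow_add hxy, hq', hq]; push_cast; ring_nf
    rw [e]; exact NI.mem_mul (xyPow_mem h (m / 2)) (chAt_mem h ⟨‹_›, hx0, ‹_›, hy0, ‹_›⟩ 0)

/-- **The term enclosure**: `Fval j m0i r m ∋ f_d(E)` at `E = j + m0i + m/2^r`. [folklore] -/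
theorem Fval_mem {d : MDat} {r : RDat} (h : d.Models P r) (hr : r.ok) (j m0i rr m : ℕ) :
    (Fval P d j m0i rr m).mem P (fM r.c r.x r.y j ((j : ℝ) + m0i + m / 2 ^ rr)) := by
  have hx0 := hr.2.1; have hy0 := hr.2.2.2.1
  have hxy : 0 < r.x * r.y := mul_pos hx0 hy0
  have e : fM r.c r.x r.y j ((j : ℝ) + m0i + m / 2 ^ rr) =
      r.c * (r.x ^ j + r.y ^ j) * (r.x * r.y) ^ ((m0i : ℝ) / 2) *
        ((r.x * r.y) ^ ((1 : ℝ) / 2 ^ (rr + 1))) ^ m := by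
    unfold fM
    rw [← Real.rpow_natCast _ m, ← Real.rpow_mul hxy.le, mul_assoc (r.c * (r.x ^ j + r.y ^ j)),
      ← Real.rpow_add hxy]
    congr 2
    rw [pow_succ]; field_simp; ring
  rw [e]
  unfold Fval
  exact NI.mem_mul (NI.mem_mul (NI.mem_mul h.cabs (powSum_mem h j)) (xyHalf_mem h hr m0i))
    (NI.mem_powN (chAt_mem h hr rr) m)

/-- **The three sums enclose `F`, `F`, `G`** at `E = j + m0i + m/2^r` (scaled by `2^P`). [folklore] -/
theorem ptSums_spec {ds : List MDat} {rds : List RDat} (h : List.Forall₂ (MDat.Models P) ds rds)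
    (hok : ∀ r ∈ rds, r.ok) (j m0i rr m : ℕ) :
    ((ptSums P j m0i rr m ds).1 : ℝ) ≤ Fpos rds j ((j : ℝ) + m0i + m / 2 ^ rr) * 2 ^ P ∧
    Fpos rds j ((j : ℝ) + m0i + m / 2 ^ rr) * 2 ^ P ≤ ((ptSums P j m0i rr m ds).2.1 : ℝ) ∧
    Fneg rds j ((j : ℝ) + m0i + m / 2 ^ rr) * 2 ^ P ≤ ((ptSums P j m0i rr m ds).2.2 : ℝ) := by
  induction h with
  | nil => simp [ptSums, Fpos, Fneg]
  | @cons d r dtl rtl hd _ ih =>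
    obtain ⟨ih1, ih2, ih3⟩ := ih (fun r' hr' => hok r' (List.mem_cons_of_mem _ hr'))
    have hr := hok r List.mem_cons_self
    have hF := Fval_mem hd hr j m0i rr m
    have hf0 := fM_nonneg hr.1 hr.2.1 hr.2.2.2.1 j ((j : ℝ) + m0i + m / 2 ^ rr)
    obtain ⟨hF1, hF2⟩ := hF
    simp only [ptSums, Fpos, Fneg, List.map_cons, List.sum_cons, hd.sign]
    cases r.σ
    · simp only [Bool.false_eq_true, ↓reduceIte, Nat.cast_add, zero_add]
      refine ⟨?_, ?_, ?_⟩
      · simpa [Fpos] using ih1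
      · simpa [Fpos] using ih2
      · have := ih3; simp only [Fneg] at this; linarith
    · simp only [↓reduceIte, Nat.cast_add, zero_add]
      refine ⟨?_, ?_, ?_⟩
      · have := ih1; simp only [Fpos] at this; linarith
      · have := ih2; simp only [Fpos] at this; linarith
      · simpa [Fneg] using ih3

/-- **One cell from its three sums**: with `s0, s1, s2` the point sums at `c, c+H, c+2H`,
`cellOK s0 s1 s2 ⇒ Φ_j ≥ 0` on `[c, c+H]`. [folklore] -/
theorem Phi_nonneg_of_cellOK {rds : List RDat} (hok : ∀ r ∈ rds, r.ok) {j : ℕ} {c H : ℝ}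
    (hH : 0 < H) {s0 s1 s2 : ℕ × ℕ × ℕ} (h0 : Fneg rds j c * 2 ^ P ≤ (s0.2.2 : ℝ))
    (h1a : (s1.1 : ℝ) ≤ Fpos rds j (c + H) * 2 ^ P) (h1c : Fneg rds j (c + H) * 2 ^ P ≤ (s1.2.2 : ℝ))
    (h2b : Fpos rds j (c + 2 * H) * 2 ^ P ≤ (s2.2.1 : ℝ)) (hc : cellOK s0 s1 s2 = true) :
    ∀ E ∈ Icc c (c + H), 0 ≤ Phi rds j E := by
  simp only [cellOK, Bool.and_eq_true, decide_eq_true_eq] at hc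
  obtain ⟨hc1, hc2⟩ := hc
  have hc1' : (s1.2.2 : ℝ) ≤ s1.1 := by exact_mod_cast hc1
  have hc2' : (s2.2.1 : ℝ) + s0.2.2 ≤ 2 * s1.1 := by exact_mod_cast hc2
  have h2P : (0 : ℝ) < 2 ^ P := pow_pos two_pos P
  have k1 : Fneg rds j (c + H) ≤ Fpos rds j (c + H) := le_of_mul_le_mul_right (by linarith) h2P
  have k2 : Fpos rds j (c + 2 * H) + Fneg rds j c ≤ 2 * Fpos rds j (c + H) :=
    le_of_mul_le_mul_right (by linarith) h2P
  intro E hE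
  rw [Phi_eq]
  exact sub_nonneg.2 (cell_nonneg_of_convex (convexOn_Fpos hok j) (convexOn_Fneg hok j) hH k1 k2 hE)

/-- Reading a mapped range. [folklore] -/
theorem getD_map_range {α : Type} (f : ℕ → α) (dflt : α) {N i : ℕ} (hi : i < N) :
    ((List.range N).map f).getD i dflt = f i := by
  rw [List.getD_eq_getElem _ _ (by simpa using hi)]
  simp

/-- **Soundness of `fineOK`**: unit cell `i` refined to depth `r ≥ 0`. With `A = j + m0 + i`:
`fineOK ⇒ Φ_j ≥ 0` on `[A, A+1]`. [folklore] -/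
theorem fineOK_sound {ds : List MDat} {rds : List RDat} (h : List.Forall₂ (MDat.Models P) ds rds)
    (hok : ∀ r ∈ rds, r.ok) {j m0 i r : ℕ} (hc : fineOK P ds j m0 i r = true) :
    ∀ E : ℝ, (j : ℝ) + m0 + i ≤ E → E ≤ (j : ℝ) + m0 + i + 1 → 0 ≤ Phi rds j E := by
  intro E hE1 hE2
  have h2r : (0 : ℝ) < 2 ^ r := pow_pos two_pos r
  obtain ⟨k, hk, hk1, hk2⟩ := exists_fine_cell r hE1 hE2
  unfold fineOK at hc
  have hcell := allBelow_spec hc k hk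
  rw [getD_map_range _ _ (by omega : k < 2 ^ r + 2), getD_map_range _ _ (by omega : k + 1 < 2 ^ r + 2),
    getD_map_range _ _ (by omega : k + 2 < 2 ^ r + 2)] at hcell
  have S0 := ptSums_spec h hok j (m0 + i) r k
  have S1 := ptSums_spec h hok j (m0 + i) r (k + 1)
  have S2 := ptSums_spec h hok j (m0 + i) r (k + 2)
  have eA : ∀ m : ℕ, (j : ℝ) + ((m0 + i : ℕ) : ℝ) + (m : ℝ) / 2 ^ r = ((j : ℝ) + m0 + i) + m / 2 ^ r := by
    intro m; push_cast; ring
  rw [eA] at S0 S1 S2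
  have e1 : ((j : ℝ) + m0 + i) + ((k + 1 : ℕ) : ℝ) / 2 ^ r = ((j : ℝ) + m0 + i + k / 2 ^ r) + 1 / 2 ^ r := by
    push_cast; ring
  have e2 : ((j : ℝ) + m0 + i) + ((k + 2 : ℕ) : ℝ) / 2 ^ r =
      ((j : ℝ) + m0 + i + k / 2 ^ r) + 2 * (1 / 2 ^ r) := by
    push_cast; ring
  rw [e1] at S1
  rw [e2] at S2
  refine Phi_nonneg_of_cellOK hok (one_div_pos.2 h2r) S0.2.2 S1.1 S1.2.2 S2.2.1 hcell E ⟨hk1, ?_⟩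
  have : (j : ℝ) + m0 + i + (k + 1) / 2 ^ r = (j : ℝ) + m0 + i + k / 2 ^ r + 1 / 2 ^ r := by ring
  rw [← this]; exact hk2

/-- **Soundness of `checkJ`**: `Φ_j ≥ 0` on `[max(E₀, j), Δ⋆)`. [folklore] -/
theorem checkJ_sound {ds : List MDat} {rds : List RDat} (h : List.Forall₂ (MDat.Models P) ds rds)
    (hok : ∀ r ∈ rds, r.ok) {exc : List (ℕ × ℕ × ℕ)} {E0 Dstar j : ℕ}
    (hc : checkJ P ds exc E0 Dstar j = true) :
    ∀ E : ℝ, ((max E0 j : ℕ) : ℝ) ≤ E → E < Dstar → 0 ≤ Phi rds j E := by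
  intro E hE1 hE2
  set Ea := max E0 j with hEa
  set m0 := Ea - j with hm0
  set n := Dstar - Ea with hn
  have hjEa : j ≤ Ea := le_max_right _ _
  have hA : (Ea : ℝ) = (j : ℝ) + m0 := by
    rw [hm0, Nat.cast_sub hjEa]; ring
  have hEn : E < (Ea : ℝ) + n := by
    have : Dstar ≤ Ea + n := by rw [hn]; omega
    have : (Dstar : ℝ) ≤ (Ea : ℝ) + n := by exact_mod_cast this
    linarith
  obtain ⟨i, hi, hi1, hi2⟩ := exists_unit_cell hE1 hEn
  unfold checkJ at hc
  have hcell := allBelow_spec hc i hi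
  split_ifs at hcell with hdepth
  · -- unrefined unit cell: the integer-point sums
    rw [getD_map_range _ _ (by omega : i < n + 2), getD_map_range _ _ (by omega : i + 1 < n + 2),
      getD_map_range _ _ (by omega : i + 2 < n + 2)] at hcell
    have S0 := ptSums_spec h hok j (m0 + i) 0 0
    have S1 := ptSums_spec h hok j (m0 + (i + 1)) 0 0
    have S2 := ptSums_spec h hok j (m0 + (i + 2)) 0 0
    have e0 : (j : ℝ) + ((m0 + i : ℕ) : ℝ) + ((0 : ℕ) : ℝ) / 2 ^ 0 = (Ea : ℝ) + i := by
      rw [hA]; push_cast; ring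
    have e1 : (j : ℝ) + ((m0 + (i + 1) : ℕ) : ℝ) + ((0 : ℕ) : ℝ) / 2 ^ 0 = ((Ea : ℝ) + i) + 1 := by
      rw [hA]; push_cast; ring
    have e2 : (j : ℝ) + ((m0 + (i + 2) : ℕ) : ℝ) + ((0 : ℕ) : ℝ) / 2 ^ 0 = ((Ea : ℝ) + i) + 2 * 1 := by
      rw [hA]; push_cast; ring
    rw [e0] at S0; rw [e1] at S1; rw [e2] at S2
    exact Phi_nonneg_of_cellOK hok one_pos S0.2.2 S1.1 S1.2.2 S2.2.1 hcell E ⟨hi1, hi2⟩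
  · -- refined unit cell
    have hf := fineOK_sound h hok hcell
    have e : (j : ℝ) + m0 + i = (Ea : ℝ) + i := by rw [hA]
    rw [e] at hf
    exact hf E hi1 hi2

/-- **Soundness of `checkRange`**: every `j ∈ [jlo, jlo + cnt)` passes `checkJ`. [folklore] -/
theorem checkRange_sound {ds : List MDat} {exc : List (ℕ × ℕ × ℕ)} {E0 Dstar jlo cnt : ℕ}
    (hc : checkRange P ds exc E0 Dstar jlo cnt = true) :
    ∀ j, jlo ≤ j → j < jlo + cnt → checkJ P ds exc E0 Dstar j = true := by
  intro j h1 h2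
  have := allBelow_spec hc (j - jlo) (by omega)
  simpa [show jlo + (j - jlo) = j by omega] using this

end sound

/-! ### The end result: obligation (M) from the kernel checks -/

/-- **Obligation (M) from the checker.** For rational nodes in the open square and weights `w`: if
`checkJ` passes for every `j < Δ⋆` (at any precision `P`, chain depth and exception table), then
`φ[F_-[x^a y^b + x^b y^a]] ≥ 0` for all `a, b ≥ 0` with `E₀ ≤ a + b < Δ⋆` and `a - b ∈ ℤ`, `φ` the
point functional at `Δ_σ = 1/8`. PROVED (`checkJ_sound` + `pointFunctional_pairPow_eq_Phi`).
[folklore] -/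
theorem pair_nonneg_of_checkAll {n : ℕ} (w z zb : Fin n → ℚ) (hz : ∀ k, 0 < z k ∧ z k < 1)
    (hzb : ∀ k, 0 < zb k ∧ zb k < 1) (P depth E0 Dstar : ℕ) (exc : List (ℕ × ℕ × ℕ))
    (hall : ∀ j < Dstar, checkJ P (mkData P depth w z zb) exc E0 Dstar j = true) :
    ∀ a b : ℝ, 0 ≤ a → 0 ≤ b → (E0 : ℝ) ≤ a + b → a + b < Dstar → (∃ q : ℤ, a - b = q) →
      0 ≤ pointFunctional (fun k => ((w k : ℚ) : ℝ)) (fun k => ((z k : ℚ) : ℝ))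
        (fun k => ((zb k : ℚ) : ℝ)) (crossF (1 / 8) (-1) (pairPow a b)) := by
  intro a b ha hb hE hD ⟨q, hq⟩
  obtain ⟨j, hj'⟩ : ∃ j : ℕ, a - b = j ∨ b - a = j := by
    refine ⟨q.natAbs, ?_⟩
    rcases Int.natAbs_eq q with h | h
    · left
      have : (q : ℝ) = ((q.natAbs : ℕ) : ℝ) :=
        (congrArg (Int.cast : ℤ → ℝ) h).trans (Int.cast_natCast _)
      linarith
    · right
      have : (q : ℝ) = -((q.natAbs : ℕ) : ℝ) := by
        have := congrArg (Int.cast : ℤ → ℝ) h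
        rw [Int.cast_neg, Int.cast_natCast] at this
        exact this
      linarith
  have hjE : (j : ℝ) ≤ a + b := by rcases hj' with h | h <;> linarith
  have hjD : j < Dstar := by
    have : (j : ℝ) < (Dstar : ℝ) := lt_of_le_of_lt hjE hD
    exact_mod_cast this
  have hmax : ((max E0 j : ℕ) : ℝ) ≤ a + b := by
    rw [Nat.cast_max]; exact max_le hE hjE
  rw [pointFunctional_pairPow_eq_Phi w z zb hz hzb hj']
  exact checkJ_sound (mkData_models P depth w z zb hz hzb) (realData_ok w z zb hz hzb) (hall j hjD)
    (a + b) hmax hD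

end Summit.CriticalPhenomena.Ising3D.Control2D
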